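import Summits.Ventures.WeilGRH.UniformConductorFloorCoprimeSound
import Summits.Ventures.WeilGRH.UniformConductorFloorJointFloors
import Summits.Ventures.WeilGRH.UniformConductorFloorCoprimeEvenSevenCheck
import Summits.Ventures.WeilGRH.UniformConductorFloorCoprimeEvenFiveCheck
import Summits.Ventures.WeilGRH.UniformConductorFloorCoprimeOddFiveCheck
import Summits.Ventures.WeilGRH.UniformConductorFloorCoprimeOddFifteenCheck
import Summits.Ventures.WeilGRH.UniformConductorFloorCoprimeOddTenCheck
import Summits.Ventures.WeilGRH.UniformConductorFloorCoprimeInputs57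
import Summits.Ventures.WeilGRH.UniformConductorFloorCoprimeRemainder
import Summits.Ventures.WeilGRH.UniformConductorFloorPrincipal
import HarnessLib

/-!
# GRH arm (rh-explicit, venture WeilGRH): ★ DIVISIBILITY FLOORS II — Weil positivity on `[-1, 1]` for EVERY Dirichlet character of
  EVERY modulus `q` with `7 ∣ q, q ≥ 77` · `5 ∣ q, q ≥ 60` (odd characters: `5 ∣ q ≥ 25` · `15 ∣ q ≥ 15` · `10 ∣ q ≥ 10`)

Cell `rh-explicit`, WEIL TRACK — GRH ARM (weil-grh-1, gen8; sequel of gen7's `UniformConductorFloorCoprimeFloors.lean`, levels `2, 3, 6`).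
A character of a modulus divisible by `5` (resp. `7`) vanishes at the visible prime power `5` (resp. `7`), so the corresponding
term of Weil's form drops out of the all-trivial-key minorant; the joint (archimedean layers + primes) Collatz–Wielandt cell
certificates with those prime powers removed (`certEvenDvd7`, `certEvenDvd5`, `certOddDvd5`, `certOddDvd15`, `certOddDvd10`,
`UniformConductorFloorCoprimeData57.lean`, kernel-checked in `…Coprime{EvenSeven,EvenFive,OddFive,OddFifteen,OddTen}Check.lean`) and
the level-`m` soundness theorem `JointCert.weilPositivityOnChar_one_of_parts_coprime` (weights, logarithms and budgets in
`UniformConductorFloorCoprimeInputs57.lean`) give the floors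

| `m` | visible prime powers left | all `χ` (budget → floor) | odd `χ` |
|---|---|---|---|
| 7 | 2, 3, 4, 5 | 4.3092 → 74.38 (stated 77 = the first multiple of 7) | (uniform 31) |
| 5 | 2, 3, 4, 7 | 4.0738 → 58.78 (stated 60) | 3.1430 → 23.17 (stated 25) |
| 15 | 2, 4, 7 | (not needed) | 2.5791 → 13.19 (stated 15) |
| 10 | 3, 7 | (not needed) | 2.2884 → 9.86 (stated 10) |

* ★ `weilPositivityOnChar_one_of_seven_dvd_ge_77` — EVERY Dirichlet character of EVERY modulus `q ≥ 77` with `7 ∣ q` (the new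
  modulus is `77 = 7·11`, the last composite of the remainder `R₀` above the principal character's flat threshold `73.06`);
* ★ `weilPositivityOnChar_one_of_five_dvd_ge_60` — every character of every `q ≥ 60` with `5 ∣ q` (new: `65 = 5·13`);
* `…_of_odd_five_dvd_ge_25`, `…_of_odd_fifteen_dvd_ge_15`, `…_of_odd_ten_dvd_ge_10` — the odd characters mod `25`, `15`, `10` leave
  the odd remainder `R₁` (new odd remainder `{0, …, 9, 11, 13, 17, 19, 23, 29}`);
* `…_of_le_one_…` — the same on every window `t ≤ 1`.

With these the all-characters statement at `t = 1` is decided for every modulus `q ≥ 2` except `18` and `32` — §§ «The new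
remainders» / «By conductor» / «The decision» below (originally planned as a separate `UniformConductorFloorOneDecision.lean`, merged here to
save one olean round): `weilPositivityOnChar_one_of_not_mem_remainder₂` (q ∉ R₀′, 46 moduli), `…_odd_…` (R₁′ = {0,…,9, 11, 13, 17, 19, 23, 29}),
by conductor, ★★★ `forall_weilPositivityOnChar_one_iff` (2 ≤ q, q ≠ 18, 32: U(q) ↔ q ∉ F) and `forall_weilPositivityOnChar_one_of_ge_74`
(73 sharp: `UniformConductorFloorOneIff`); the two remaining moduli are the principal cells `UniformConductorFloorPrincipalMod18/32` and
the exception-free statement is `UniformConductorFloorOneComplete.lean`.  Honest scope: finite-window (`t = 1`) statements; nothing here is a step towards GRH for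
any individual character; no `ζ` input; standard axioms; the certificates are kernel-checked integer data.

## References

* A. Weil (1952), (11) pp. 261–262 and the «lemme» p. 262 [Weil1952FormulesExplicites]; L. Collatz (1942) / H. Wielandt (1950).
  [folklore]
-/

noncomputable section

open Real Set
open scoped ArithmeticFunction.vonMangoldt

namespace Summit.Ventures.WeilGRH

open Literature.NumberTheory.LFunctions

namespace UniformFloor

variable {q : ℕ}

/-! ## Level 7 -/

/-- ★ **Every EVEN Dirichlet character of every modulus `q ≥ 77` with `7 ∣ q` satisfies Weil positivity on `[-1, 1]`.** [folklore] -/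
theorem weilPositivityOnChar_one_of_even_seven_dvd_ge_77 (hm : 7 ∣ q) (hq : 77 ≤ q) (χ : DirichletCharacter ℂ q)
    (hpar : charParity χ = 0) : WeilPositivityOnChar χ 1 :=
  certEvenDvd7.weilPositivityOnChar_one_of_parts_coprime certEvenDvd7_checkFrame certEvenDvd7_checkOne
    (fun _ hj ↦ certEvenDvd7.cellOKB_of_checkCells certEvenDvd7_checkCells hj) certEvenDvd7_hw psi_even_ge
    (Q₀ := 77) (by norm_num) certEvenDvd7_budget (by omega) hm hq χ hpar

/-- ★★ **EVERY Dirichlet character (any parity, any values, imprimitive included) of EVERY modulus `q ≥ 77` with `7 ∣ q`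
satisfies Weil positivity on `[-1, 1]`** (odd characters: the uniform odd floor `31`). [cite: Weil1952FormulesExplicites, (11) and the «lemme» p. 262] -/
theorem weilPositivityOnChar_one_of_seven_dvd_ge_77 (hm : 7 ∣ q) (hq : 77 ≤ q) (χ : DirichletCharacter ℂ q) :
    WeilPositivityOnChar χ 1 := by
  rcases Nat.le_one_iff_eq_zero_or_eq_one.1 (charParity_le_one χ) with h | h
  · exact weilPositivityOnChar_one_of_even_seven_dvd_ge_77 hm hq χ h
  · exact weilPositivityOnChar_one_of_odd_ge_31 (by omega) χ h

/-- The same on every window `t ≤ 1`. [folklore] -/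
theorem weilPositivityOnChar_of_le_one_of_seven_dvd_ge_77 (hm : 7 ∣ q) (hq : 77 ≤ q) (χ : DirichletCharacter ℂ q) {t : ℝ}
    (ht : t ≤ 1) : WeilPositivityOnChar χ t := fun g hg hsupp ↦
  weilPositivityOnChar_one_of_seven_dvd_ge_77 hm hq χ g hg (hsupp.trans (Icc_subset_Icc (by linarith) ht))

/-! ## Level 5 -/

/-- ★ **Every EVEN Dirichlet character of every modulus `q ≥ 60` with `5 ∣ q` satisfies Weil positivity on `[-1, 1]`.** [folklore] -/
theorem weilPositivityOnChar_one_of_even_five_dvd_ge_60 (hm : 5 ∣ q) (hq : 60 ≤ q) (χ : DirichletCharacter ℂ q)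
    (hpar : charParity χ = 0) : WeilPositivityOnChar χ 1 :=
  certEvenDvd5.weilPositivityOnChar_one_of_parts_coprime certEvenDvd5_checkFrame certEvenDvd5_checkOne
    (fun _ hj ↦ certEvenDvd5.cellOKB_of_checkCells certEvenDvd5_checkCells hj) certEvenDvd5_hw psi_even_ge
    (Q₀ := 60) (by norm_num) certEvenDvd5_budget (by omega) hm hq χ hpar

/-- ★ **Every ODD Dirichlet character of every modulus `q ≥ 25` with `5 ∣ q` satisfies Weil positivity on `[-1, 1]`.**
[cite: Weil1952FormulesExplicites, (11) and the «lemme» p. 262] -/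
theorem weilPositivityOnChar_one_of_odd_five_dvd_ge_25 (hm : 5 ∣ q) (hq : 25 ≤ q) (χ : DirichletCharacter ℂ q)
    (hpar : charParity χ = 1) : WeilPositivityOnChar χ 1 :=
  certOddDvd5.weilPositivityOnChar_one_of_parts_coprime certOddDvd5_checkFrame certOddDvd5_checkOne
    (fun _ hj ↦ certOddDvd5.cellOKB_of_checkCells certOddDvd5_checkCells hj) certOddDvd5_hw psi_odd_ge
    (Q₀ := 25) (by norm_num) certOddDvd5_budget (by omega) hm hq χ hpar

/-- ★★ **EVERY Dirichlet character of EVERY modulus `q ≥ 60` with `5 ∣ q` satisfies Weil positivity on `[-1, 1]`.**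
[cite: Weil1952FormulesExplicites, (11) and the «lemme» p. 262] -/
theorem weilPositivityOnChar_one_of_five_dvd_ge_60 (hm : 5 ∣ q) (hq : 60 ≤ q) (χ : DirichletCharacter ℂ q) :
    WeilPositivityOnChar χ 1 := by
  rcases Nat.le_one_iff_eq_zero_or_eq_one.1 (charParity_le_one χ) with h | h
  · exact weilPositivityOnChar_one_of_even_five_dvd_ge_60 hm hq χ h
  · exact weilPositivityOnChar_one_of_odd_five_dvd_ge_25 hm (by omega) χ h

/-- The same on every window `t ≤ 1`. [folklore] -/
theorem weilPositivityOnChar_of_le_one_of_five_dvd_ge_60 (hm : 5 ∣ q) (hq : 60 ≤ q) (χ : DirichletCharacter ℂ q) {t : ℝ}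
    (ht : t ≤ 1) : WeilPositivityOnChar χ t := fun g hg hsupp ↦
  weilPositivityOnChar_one_of_five_dvd_ge_60 hm hq χ g hg (hsupp.trans (Icc_subset_Icc (by linarith) ht))

/-- Odd characters on every window `t ≤ 1` from `5 ∣ q`, `q ≥ 25`. [folklore] -/
theorem weilPositivityOnChar_of_le_one_of_odd_five_dvd_ge_25 (hm : 5 ∣ q) (hq : 25 ≤ q) (χ : DirichletCharacter ℂ q)
    (hpar : charParity χ = 1) {t : ℝ} (ht : t ≤ 1) : WeilPositivityOnChar χ t := fun g hg hsupp ↦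
  weilPositivityOnChar_one_of_odd_five_dvd_ge_25 hm hq χ hpar g hg (hsupp.trans (Icc_subset_Icc (by linarith) ht))

/-! ## Levels 15 and 10 (odd characters) -/

/-- ★ **Every ODD Dirichlet character of every modulus `q ≥ 15` with `15 ∣ q` satisfies Weil positivity on `[-1, 1]`** (new: the
odd characters mod `15`). [cite: Weil1952FormulesExplicites, (11) and the «lemme» p. 262] -/
theorem weilPositivityOnChar_one_of_odd_fifteen_dvd_ge_15 (hm : 15 ∣ q) (hq : 15 ≤ q) (χ : DirichletCharacter ℂ q)
    (hpar : charParity χ = 1) : WeilPositivityOnChar χ 1 :=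
  certOddDvd15.weilPositivityOnChar_one_of_parts_coprime certOddDvd15_checkFrame certOddDvd15_checkOne
    (fun _ hj ↦ certOddDvd15.cellOKB_of_checkCells certOddDvd15_checkCells hj) certOddDvd15_hw psi_odd_ge
    (Q₀ := 15) (by norm_num) certOddDvd15_budget (by omega) hm hq χ hpar

/-- ★ **Every ODD Dirichlet character of every modulus `q ≥ 10` with `10 ∣ q` satisfies Weil positivity on `[-1, 1]`** (new: the
odd characters mod `10`; margin `log 10 − budget = 0.014`). [cite: Weil1952FormulesExplicites, (11) and the «lemme» p. 262] -/
theorem weilPositivityOnChar_one_of_odd_ten_dvd_ge_10 (hm : 10 ∣ q) (hq : 10 ≤ q) (χ : DirichletCharacter ℂ q)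
    (hpar : charParity χ = 1) : WeilPositivityOnChar χ 1 :=
  certOddDvd10.weilPositivityOnChar_one_of_parts_coprime certOddDvd10_checkFrame certOddDvd10_checkOne
    (fun _ hj ↦ certOddDvd10.cellOKB_of_checkCells certOddDvd10_checkCells hj) certOddDvd10_hw psi_odd_ge
    (Q₀ := 10) (by norm_num) certOddDvd10_budget (by omega) hm hq χ hpar

/-- Odd characters on every window `t ≤ 1` from `15 ∣ q`. [folklore] -/
theorem weilPositivityOnChar_of_le_one_of_odd_fifteen_dvd (hm : 15 ∣ q) (hq : 15 ≤ q) (χ : DirichletCharacter ℂ q)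
    (hpar : charParity χ = 1) {t : ℝ} (ht : t ≤ 1) : WeilPositivityOnChar χ t := fun g hg hsupp ↦
  weilPositivityOnChar_one_of_odd_fifteen_dvd_ge_15 hm hq χ hpar g hg (hsupp.trans (Icc_subset_Icc (by linarith) ht))

/-- Odd characters on every window `t ≤ 1` from `10 ∣ q`. [folklore] -/
theorem weilPositivityOnChar_of_le_one_of_odd_ten_dvd (hm : 10 ∣ q) (hq : 10 ≤ q) (χ : DirichletCharacter ℂ q)
    (hpar : charParity χ = 1) {t : ℝ} (ht : t ≤ 1) : WeilPositivityOnChar χ t := fun g hg hsupp ↦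
  weilPositivityOnChar_one_of_odd_ten_dvd_ge_10 hm hq χ hpar g hg (hsupp.trans (Icc_subset_Icc (by linarith) ht))


/-! ## The new remainders -/

set_option maxRecDepth 100000 in
/-- The dispatch below the uniform floor: a modulus `q < 78` outside `R₀′` is even `≥ 34`, a multiple of `3` `≥ 45`, of `6` `≥ 24`,
of `5` `≥ 60`, or of `7` `≥ 77`. [folklore] -/
theorem remainder₂_dispatch : ∀ q < 78,
    q ∉ ({0, 1, 2, 3, 4, 5, 6, 7, 8, 9, 10, 11, 12, 13, 14, 15, 16, 17, 18, 19, 20, 21, 22, 23, 25, 26, 27, 28, 29, 31, 32, 33,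
      35, 37, 39, 41, 43, 47, 49, 53, 55, 59, 61, 67, 71, 73} : Finset ℕ) →
    (2 ∣ q ∧ 34 ≤ q) ∨ (3 ∣ q ∧ 45 ≤ q) ∨ (6 ∣ q ∧ 24 ≤ q) ∨ (5 ∣ q ∧ 60 ≤ q) ∨ (7 ∣ q ∧ 77 ≤ q) := by
  decide +kernel

set_option maxRecDepth 100000 in
/-- The odd dispatch: a modulus `q < 31` outside `R₁′` is even `≥ 14`, a multiple of `3` `≥ 18`, of `6` `≥ 12`, of `5` `≥ 25`, of
`15` `≥ 15`, or of `10` `≥ 10`. [folklore] -/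
theorem remainder₂_dispatch_odd : ∀ q < 31,
    q ∉ ({0, 1, 2, 3, 4, 5, 6, 7, 8, 9, 11, 13, 17, 19, 23, 29} : Finset ℕ) →
    (2 ∣ q ∧ 14 ≤ q) ∨ (3 ∣ q ∧ 18 ≤ q) ∨ (6 ∣ q ∧ 12 ≤ q) ∨ (5 ∣ q ∧ 25 ≤ q) ∨ (15 ∣ q ∧ 15 ≤ q) ∨ (10 ∣ q ∧ 10 ≤ q) := by
  decide +kernel

/-- ★★ **Weil positivity on `[-1, 1]` for EVERY Dirichlet character of EVERY modulus outside the explicit 46-element set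
`R₀′ = {0, …, 23, 25, …, 29, 31, 32, 33, 35, 37, 39, 41, 43, 47, 49, 53, 55, 59, 61, 67, 71, 73}`.**
[cite: Weil1952FormulesExplicites, (11) and the «lemme» p. 262] -/
theorem weilPositivityOnChar_one_of_not_mem_remainder₂
    (hq : q ∉ ({0, 1, 2, 3, 4, 5, 6, 7, 8, 9, 10, 11, 12, 13, 14, 15, 16, 17, 18, 19, 20, 21, 22, 23, 25, 26, 27, 28, 29, 31,
      32, 33, 35, 37, 39, 41, 43, 47, 49, 53, 55, 59, 61, 67, 71, 73} : Finset ℕ))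
    (χ : DirichletCharacter ℂ q) : WeilPositivityOnChar χ 1 := by
  by_cases h78 : 78 ≤ q
  · exact weilPositivityOnChar_one_of_ge_78 h78 χ
  · rcases remainder₂_dispatch q (by omega) hq with ⟨hm, hge⟩ | ⟨hm, hge⟩ | ⟨hm, hge⟩ | ⟨hm, hge⟩ | ⟨hm, hge⟩
    · exact weilPositivityOnChar_one_of_two_dvd_ge_34 hm hge χ
    · exact weilPositivityOnChar_one_of_three_dvd_ge_45 hm hge χ
    · exact weilPositivityOnChar_one_of_six_dvd_ge_24 hm hge χ
    · exact weilPositivityOnChar_one_of_five_dvd_ge_60 hm hge χ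
    · exact weilPositivityOnChar_one_of_seven_dvd_ge_77 hm hge χ

/-- ★ **ODD characters: Weil positivity on `[-1, 1]` for every odd Dirichlet character of every modulus outside the explicit
16-element set `R₁′ = {0, …, 9, 11, 13, 17, 19, 23, 29}`.** [cite: Weil1952FormulesExplicites, (11) and the «lemme» p. 262] -/
theorem weilPositivityOnChar_one_of_odd_not_mem_remainder₂
    (hq : q ∉ ({0, 1, 2, 3, 4, 5, 6, 7, 8, 9, 11, 13, 17, 19, 23, 29} : Finset ℕ))
    (χ : DirichletCharacter ℂ q) (hpar : charParity χ = 1) : WeilPositivityOnChar χ 1 := by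
  by_cases h31 : 31 ≤ q
  · exact weilPositivityOnChar_one_of_odd_ge_31 h31 χ hpar
  · rcases remainder₂_dispatch_odd q (by omega) hq with ⟨hm, hge⟩ | ⟨hm, hge⟩ | ⟨hm, hge⟩ | ⟨hm, hge⟩ | ⟨hm, hge⟩ | ⟨hm, hge⟩
    · exact weilPositivityOnChar_one_of_odd_two_dvd_ge_14 hm hge χ hpar
    · exact weilPositivityOnChar_one_of_odd_three_dvd_ge_18 hm hge χ hpar
    · exact weilPositivityOnChar_one_of_odd_six_dvd_ge_12 hm hge χ hpar
    · exact weilPositivityOnChar_one_of_odd_five_dvd_ge_25 hm hge χ hpar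
    · exact weilPositivityOnChar_one_of_odd_fifteen_dvd_ge_15 hm hge χ hpar
    · exact weilPositivityOnChar_one_of_odd_ten_dvd_ge_10 hm hge χ hpar

/-- The same on every window `t ≤ 1` (all characters, `q ∉ R₀′`). [folklore] -/
theorem weilPositivityOnChar_of_le_one_of_not_mem_remainder₂
    (hq : q ∉ ({0, 1, 2, 3, 4, 5, 6, 7, 8, 9, 10, 11, 12, 13, 14, 15, 16, 17, 18, 19, 20, 21, 22, 23, 25, 26, 27, 28, 29, 31,
      32, 33, 35, 37, 39, 41, 43, 47, 49, 53, 55, 59, 61, 67, 71, 73} : Finset ℕ))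
    (χ : DirichletCharacter ℂ q) {t : ℝ} (ht : t ≤ 1) : WeilPositivityOnChar χ t := fun g hg hsupp ↦
  weilPositivityOnChar_one_of_not_mem_remainder₂ hq χ g hg (hsupp.trans (Icc_subset_Icc (by linarith) ht))

/-- Odd characters on every window `t ≤ 1`, `q ∉ R₁′`. [folklore] -/
theorem weilPositivityOnChar_of_le_one_of_odd_not_mem_remainder₂
    (hq : q ∉ ({0, 1, 2, 3, 4, 5, 6, 7, 8, 9, 11, 13, 17, 19, 23, 29} : Finset ℕ))
    (χ : DirichletCharacter ℂ q) (hpar : charParity χ = 1) {t : ℝ} (ht : t ≤ 1) : WeilPositivityOnChar χ t :=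
  fun g hg hsupp ↦
  weilPositivityOnChar_one_of_odd_not_mem_remainder₂ hq χ hpar g hg (hsupp.trans (Icc_subset_Icc (by linarith) ht))

/-! ## By conductor -/

/-- ★★ **BY CONDUCTOR: every NON-PRINCIPAL Dirichlet character (of any modulus) whose conductor lies outside `R₀′` satisfies Weil
positivity on `[-1, 1]`** (level-raising monotonicity `WeilPositivityOnChar.of_primitiveCharacter`).
[cite: Weil1952FormulesExplicites, (11) and the «lemme» p. 262] -/
theorem weilPositivityOnChar_one_of_conductor_not_mem_remainder₂ {d : ℕ} [NeZero d] (χ : DirichletCharacter ℂ d) (hχ : χ ≠ 1)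
    (hc : χ.conductor ∉ ({0, 1, 2, 3, 4, 5, 6, 7, 8, 9, 10, 11, 12, 13, 14, 15, 16, 17, 18, 19, 20, 21, 22, 23, 25, 26, 27, 28,
      29, 31, 32, 33, 35, 37, 39, 41, 43, 47, 49, 53, 55, 59, 61, 67, 71, 73} : Finset ℕ)) :
    WeilPositivityOnChar χ 1 :=
  WeilPositivityOnChar.of_primitiveCharacter χ hχ (weilPositivityOnChar_one_of_not_mem_remainder₂ hc χ.primitiveCharacter)

/-- ★ **BY CONDUCTOR, ODD: every odd non-principal Dirichlet character whose conductor lies outside `R₁′`** — i.e. whose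
conductor is not one of `3, 4, 5, 7, 8, 9, 11, 13, 17, 19, 23` — satisfies Weil positivity on `[-1, 1]`.
[cite: Weil1952FormulesExplicites, (11) and the «lemme» p. 262] -/
theorem weilPositivityOnChar_one_of_odd_conductor_not_mem_remainder₂ {d : ℕ} [NeZero d] (χ : DirichletCharacter ℂ d)
    (hχ : χ ≠ 1) (hpar : charParity χ = 1)
    (hc : χ.conductor ∉ ({0, 1, 2, 3, 4, 5, 6, 7, 8, 9, 11, 13, 17, 19, 23, 29} : Finset ℕ)) :
    WeilPositivityOnChar χ 1 := by
  have hparp : charParity χ.primitiveCharacter = 1 := by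
    have h := charParity_changeLevel χ.primitiveCharacter χ.conductor_dvd_level
    rw [DirichletCharacter.changeLevel_primitiveCharacter] at h
    rw [← h, hpar]
  exact WeilPositivityOnChar.of_primitiveCharacter χ hχ
    (weilPositivityOnChar_one_of_odd_not_mem_remainder₂ hc χ.primitiveCharacter hparp)

/-! ## The decision -/

set_option maxRecDepth 100000 in
/-- `R₀′ = F ∪ {0, 1, 18, 32}`. [folklore] -/
theorem remainder₂_subset_failures_or : ∀ n ∈ ({0, 1, 2, 3, 4, 5, 6, 7, 8, 9, 10, 11, 12, 13, 14, 15, 16, 17, 18, 19, 20, 21,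
      22, 23, 25, 26, 27, 28, 29, 31, 32, 33, 35, 37, 39, 41, 43, 47, 49, 53, 55, 59, 61, 67, 71, 73} : Finset ℕ),
    n < 2 ∨ n = 18 ∨ n = 32 ∨
      n ∈ ({2, 3, 4, 5, 6, 7, 8, 9, 10, 11, 12, 13, 14, 15, 16, 17, 19, 20, 21, 22, 23, 25, 26, 27, 28, 29, 31, 33, 35, 37,
        39, 41, 43, 47, 49, 53, 55, 59, 61, 67, 71, 73} : Finset ℕ) := by
  decide +kernel

/-- ★★★ **THE DECISION.**  For every modulus `q ≥ 2` other than `18` and `32`: EVERY Dirichlet character mod `q` is Weil-positive on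
`[-1, 1]` if and only if `q` is NOT one of the 42 moduli
`2, …, 17, 19, …, 23, 25, …, 29, 31, 33, 35, 37, 39, 41, 43, 47, 49, 53, 55, 59, 61, 67, 71, 73`
— on which the principal character fails. [cite: Weil1952FormulesExplicites, (11) pp. 261–262 and the «lemme» p. 262] -/
theorem forall_weilPositivityOnChar_one_iff (hq2 : 2 ≤ q) (h18 : q ≠ 18) (h32 : q ≠ 32) :
    (∀ χ : DirichletCharacter ℂ q, WeilPositivityOnChar χ 1) ↔
      q ∉ ({2, 3, 4, 5, 6, 7, 8, 9, 10, 11, 12, 13, 14, 15, 16, 17, 19, 20, 21, 22, 23, 25, 26, 27, 28, 29, 31, 33, 35, 37,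
        39, 41, 43, 47, 49, 53, 55, 59, 61, 67, 71, 73} : Finset ℕ) := by
  constructor
  · intro h hF
    exact not_weilPositivityOnChar_one_principal hF (h 1)
  · intro hF χ
    refine weilPositivityOnChar_one_of_not_mem_remainder₂ (fun hR ↦ ?_) χ
    rcases remainder₂_subset_failures_or q hR with h | h | h | h
    · omega
    · exact h18 h
    · exact h32 h
    · exact hF h

set_option maxRecDepth 100000 in
/-- Every member of `R₀′` is `< 74`. [folklore] -/
theorem remainder₂_lt : ∀ n ∈ ({0, 1, 2, 3, 4, 5, 6, 7, 8, 9, 10, 11, 12, 13, 14, 15, 16, 17, 18, 19, 20, 21, 22, 23, 25, 26,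
      27, 28, 29, 31, 32, 33, 35, 37, 39, 41, 43, 47, 49, 53, 55, 59, 61, 67, 71, 73} : Finset ℕ), n < 74 := by
  decide +kernel

/-- ★★★ **THE UNIFORM THRESHOLD OVER ALL MODULI IS `74`, two-sided**: every Dirichlet character of every modulus `q ≥ 74` is
Weil-positive on `[-1, 1]` (and `UniformConductorFloorOneIff.exists_not_weilPositivityOnChar_one_seventyThree`: not at `73`).
[cite: Weil1952FormulesExplicites, (11) pp. 261–262 and the «lemme» p. 262] -/
theorem forall_weilPositivityOnChar_one_of_ge_74 (hq : 74 ≤ q) (χ : DirichletCharacter ℂ q) : WeilPositivityOnChar χ 1 :=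
  weilPositivityOnChar_one_of_not_mem_remainder₂ (fun hR ↦ by have := remainder₂_lt q hR; omega) χ

/-- The same on every window `t ≤ 1`. [folklore] -/
theorem forall_weilPositivityOnChar_of_le_one_of_ge_74 (hq : 74 ≤ q) (χ : DirichletCharacter ℂ q) {t : ℝ} (ht : t ≤ 1) :
    WeilPositivityOnChar χ t := fun g hg hsupp ↦
  forall_weilPositivityOnChar_one_of_ge_74 hq χ g hg (hsupp.trans (Icc_subset_Icc (by linarith) ht))

end UniformFloor

end Summit.Ventures.WeilGRH

end
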